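import Literature.AlgebraicGeometry.AbelianSchemes.AbelianSchemeOverMulNEtale
import Literature.AlgebraicGeometry.AbelianSchemes.AbelianSchemeOverSectionPow
import Literature.AlgebraicGeometry.AbelianSchemes.AbelianSchemeOverSectionsBaseChange
import Literature.AlgebraicGeometry.AbelianSchemes.LevelStructureTwist
import Literature.AlgebraicGeometry.Morphisms.SectionEqualizerClopen
import HarnessLib

/-!
# `n`-torsion sections of an abelian scheme with a level-`n` structure are LOCALLY CONSTANT

Let `X/S` be an abelian scheme with `(n : κ(s)) ≠ 0` for every `s ∈ S`, `φ` a level-`n` structure on `X/S` (basis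
sections `σ₁, …, σ_{2g} ∈ X[n](S)`, [MumfordFogartyKirwan1994] Ch. 7 §2 Def. 7.1) and `b ∈ X(S)` a section with
`b ^ n = 1`.  Then `S` is covered by CLOPEN subsets on each of which `b` coincides with one of the `n^{2g}` sections
`σ^a = φ(a)`, `a ∈ (ℤ/n)^{2g}` (`LevelStructure.exists_isClopen_comp_eq_section`): `b` and `σ^a` are sections of the
finite étale `X[n] → S` ([GortzWedhorn2023] Prop. 27.188 (1); ★ `isFinite_fst_unit_pow_id`, `etale_fst_unit_pow_id`),
the locus where two sections of an unramified separated morphism agree is open and closed ([GortzWedhorn2020]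
Prop. 9.3 / [GortzWedhorn2023] Rem. 18.30; ★ `Morphisms.isClopen_range_sectionEqualizer`), and these loci cover `S`
because at a geometric point `s̄` the `n`-torsion point `b(s̄)` is one of the `σ^a(s̄)` (Def. 7.1 (ii): the basis
sections exhaust the `n`-torsion of every geometric fibre).  Applied to a base change `X_T/T` (`φ.baseChange`, ★
`AbelianSchemeOverLevelBaseChange`) this says: every `T`-valued `n`-torsion point of `X` is, locally on `T` for the
clopen topology, a CONSTANT section — the form in which «`X[n]` is the constant group `(ℤ/n)^{2g}_S`» is consumed by
the dual-of-a-quotient construction (the stabiliser of the Poincaré family is a constant group).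

* `comp_pow_id_left_eq_of_pow_eq_one` — `b ^ n = 1` ⇒ `b ≫ [n] = ε` on underlying schemes;
* `LevelStructure.exists_section_restrict_eq` — at a geometric point, `b(s̄) = σ^a(s̄)` for some `a`;
* `LevelStructure.exists_isClopen_comp_eq_section` — the clopen cover statement (for `T`-valued points apply it to
  `A.baseChange f` with `φ.baseChange f`, ★ `AbelianSchemeOverLevelBaseChange`).

## References

* [MumfordFogartyKirwan1994] D. Mumford, J. Fogarty, F. Kirwan, *GIT* (3rd ed.), Ch. 7 §2 Def. 7.1 (p. 129).
* [GortzWedhorn2023] U. Görtz, T. Wedhorn, *Algebraic Geometry II* (2023), Prop. 27.188 (1) (p. 675); Remark 18.30.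
* [GortzWedhorn2020] U. Görtz, T. Wedhorn, *Algebraic Geometry I* (2nd ed.), Prop. 9.3, Prop. 9.5.
-/

noncomputable section

universe u

open CategoryTheory CategoryTheory.Limits AlgebraicGeometry MonoidalCategory CartesianMonoidalCategory

open scoped MonObj

namespace Literature.AlgebraicGeometry.AbelianSchemes

namespace AbelianSchemeOver

open Literature.AlgebraicGeometry.Morphisms

variable {S : Scheme.{u}} (A : AbelianSchemeOver S)

/-- An `n`-torsion section `b ∈ X(S)` (`b ^ n = 1`) satisfies `b ≫ [n]_X = ε` on underlying schemes.
[cite: MumfordFogartyKirwan1994, Ch. 7 §2 Definition 7.1 (ii) (p. 129)] -/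
theorem comp_pow_id_left_eq_of_pow_eq_one {n : ℕ} {b : A.Sections} (hb : b ^ n = 1) :
    b.left ≫ (((𝟙 A.X : A.X ⟶ A.X) ^ n : A.X ⟶ A.X)).left = (η[A.X] : 𝟙_ (Over S) ⟶ A.X).left := by
  have h := congrArg Over.Hom.left (A.pow_eq_comp_pow_id b n)
  rw [hb, one_left, Over.comp_left] at h
  exact h.symm

/-- **At a geometric point, an `n`-torsion section is one of the basis combinations**: for `b ^ n = 1` and a geometric
point `s̄ : Spec Ω → S`, `b(s̄) = σ^a(s̄)` for some `a ∈ (ℤ/n)^{2g}` (Def. 7.1 (ii): the `σ^a(s̄)` exhaust `X_{s̄}[n]`).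
[cite: MumfordFogartyKirwan1994, Ch. 7 §2 Definition 7.1 (ii) (p. 129)] -/
theorem LevelStructure.exists_section_restrict_eq {g n : ℕ} (φ : LevelStructure g n A) {b : A.Sections} (hb : b ^ n = 1)
    {Ω : Type u} [Field Ω] [IsAlgClosed Ω] (s : Spec (.of Ω) ⟶ S) :
    ∃ a : Fin g ⊕ Fin g → ZMod n, A.restrict s (φ.section_ a) = A.restrict s b := by
  have hx : A.restrict s b ^ n = 1 := by rw [← restrict_pow, hb, restrict_one]
  exact φ.basis_surjective s (A.restrict s b) hx

/-- **`n`-TORSION SECTIONS ARE LOCALLY CONSTANT for the clopen topology** (given a level-`n` structure and `n`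
invertible on the base, `X` commutative — e.g. any abelian scheme over a reduced base, ★ `isCommMonObj_of_isReduced_base`):
for `b ∈ X(S)` with `b ^ n = 1` and every `s ∈ S` there are `a ∈ (ℤ/n)^{2g}` and a CLOPEN `U ∋ s` on which `b = σ^a`. [cite: MumfordFogartyKirwan1994, Ch. 7 §2 Definition 7.1 (p. 129)]
[cite: GortzWedhorn2023, Prop. 27.188 (1) (p. 675)] -/
theorem LevelStructure.exists_isClopen_comp_eq_section [IsCommMonObj A.X] {g n : ℕ} (φ : LevelStructure g n A)
    (hn : ∀ s : S, (n : S.residueField s) ≠ 0) {b : A.Sections} (hb : b ^ n = 1) (s : S) :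
    ∃ (a : Fin g ⊕ Fin g → ZMod n) (U : S.Opens), IsClopen (U : Set S) ∧ s ∈ U ∧
      U.ι ≫ b.left = U.ι ≫ (φ.section_ a).left := by
  -- the finite étale `q : X[n] → S` and its two sections defined by `b` and `σ^a`
  let N : A.X ⟶ A.X := (𝟙 A.X : A.X ⟶ A.X) ^ n
  let q := pullback.fst (η[A.X] : 𝟙_ (Over S) ⟶ A.X).left N.left
  haveI : IsFinite q := A.isFinite_fst_unit_pow_id hn
  haveI : Etale q := A.etale_fst_unit_pow_id hn
  have hbN : b.left ≫ N.left = (η[A.X] : 𝟙_ (Over S) ⟶ A.X).left := A.comp_pow_id_left_eq_of_pow_eq_one hb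
  -- the geometric point over `s` and the exponent `a` with `b(s̄) = σ^a(s̄)`
  let Ω := AlgebraicClosure (S.residueField s)
  let sbar : Spec (.of Ω) ⟶ S :=
    Spec.map (CommRingCat.ofHom (algebraMap (S.residueField s) Ω)) ≫ S.fromSpecResidueField s
  obtain ⟨a, ha⟩ := φ.exists_section_restrict_eq A hb sbar
  have haN : (φ.section_ a).left ≫ N.left = (η[A.X] : 𝟙_ (Over S) ⟶ A.X).left :=
    A.comp_pow_id_left_eq_of_pow_eq_one (A.sectionPow_pow_eq_one φ.pow_σ a)
  let σb : S ⟶ pullback (η[A.X] : 𝟙_ (Over S) ⟶ A.X).left N.left :=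
    pullback.lift (𝟙 S) b.left ((Category.id_comp _).trans hbN.symm)
  let σa : S ⟶ pullback (η[A.X] : 𝟙_ (Over S) ⟶ A.X).left N.left :=
    pullback.lift (𝟙 S) (φ.section_ a).left ((Category.id_comp _).trans haN.symm)
  have w : σb ≫ q = σa ≫ q := by
    simp only [σb, σa, q, pullback.lift_fst]
  -- the equaliser of the two sections is clopen
  have hE := isClopen_range_sectionEqualizer (q := q) w
  refine ⟨a, ⟨_, hE.isOpen⟩, hE, ?_, ?_⟩
  · -- `s` lies in the equaliser: test with the geometric point `s̄`
    have hsb : sbar ≫ σb = sbar ≫ σa := by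
      apply pullback.hom_ext
      · simp only [Category.assoc, σb, σa, pullback.lift_fst]
      · simp only [Category.assoc, σb, σa, pullback.lift_snd]
        have h := congrArg Over.Hom.left ha
        rw [restrict_left, restrict_left] at h
        exact h.symm
    have hsub := (comp_eq_comp_iff_range_subset_sectionEqualizer (q := q) w sbar).mp hsb
    have hmem : sbar.base (IsLocalRing.closedPoint Ω) ∈ Set.range
        (pullback.snd (pullback.diagonal q) (pullback.lift σb σa w)) := hsub ⟨_, rfl⟩
    have hpt : sbar.base (IsLocalRing.closedPoint Ω) = s := by
      simp only [sbar, Scheme.Hom.comp_base, TopCat.comp_app]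
      exact Scheme.fromSpecResidueField_apply _ _
    rw [hpt] at hmem
    exact hmem
  · -- on the equaliser the two sections agree, hence so do `b` and `σ^a`
    set U : S.Opens := ⟨_, hE.isOpen⟩ with hU
    have hrange : Set.range (U.ι) ⊆
        Set.range (pullback.snd (pullback.diagonal q) (pullback.lift σb σa w)) := by
      rw [Scheme.Opens.range_ι]
      exact subset_rfl
    have hι := (comp_eq_comp_iff_range_subset_sectionEqualizer (q := q) w U.ι).mpr hrange
    have e1 : σb ≫ pullback.snd (η[A.X] : 𝟙_ (Over S) ⟶ A.X).left N.left = b.left := pullback.lift_snd _ _ _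
    have e2 : σa ≫ pullback.snd (η[A.X] : 𝟙_ (Over S) ⟶ A.X).left N.left = (φ.section_ a).left :=
      pullback.lift_snd _ _ _
    have h1 := congrArg (· ≫ pullback.snd (η[A.X] : 𝟙_ (Over S) ⟶ A.X).left N.left) hι
    simp only [Category.assoc] at h1
    erw [e1, e2] at h1
    exact h1

end AbelianSchemeOver

end Literature.AlgebraicGeometry.AbelianSchemes

end
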